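import Mathlib
import HarnessLib
import Summits.HubbardSuperconductivity.HubbardSuperconductivity.Theorems.KLProgrammeC4aPPKernelWindow

/-!
# Route `KLProgramme` — crux C4a, S3 brick (B4) «(B4)-UMK1», «(M1)-TRUE-KERNEL» adaptation (window), part 2: the flatness number of the FINITE-WINDOW pp pair kernel
# is `≤ A₁·Λ/max(D,Λ)² + (12B₁+5)(2κ₀+κ₁)/ω_M` for EVERY `D > 0` — the (N2) shape plus an `O(β/M)` constant

Cell `gate-hubbard-kl`, seat hubbard-kl-k3c3-p1 (g15; row «δμ-flow with klAngularMean constant piece»).  Continuation of `…C4aPPKernelWindow` (stub (C) of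
stmt-HubbardSuperconductivity-20437; note `M1-TRUE-KERNEL.md` §5).  The lattice's truncated frequency set `n < M` (`MatsubaraIdx M`) changes the anti-diagonal flatness
number of `…TrueFlatnessShape` only by the tail kernel `N_tail·κ/(e+u)`, whose numerator is `O(S_M·(e+u))` with `S_M = (12B₁+5)/ω_M`:
* `ppTailNumerator_zero_zero`, **`abs_ppTailNumerator_le_sum`** (`|N_tail(e,u)| ≤ S_M(e+u)` on the quadrant, two mean-value steps);
* **`tailKernel_antidiagonal_flatness_le`** — every `D > 0`: `|∫_0^D ∂ᵤK_tail(e,D−e)| ≤ S_M(2κ₀+κ₁)`;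
* continuity of the window/tail line functions, and **`windowKernel_antidiagonal_flatness_shape`** — every `D > 0`:
  `|∫_0^D ∂ᵤK_M(e,D−e)| ≤ A₁·Λ/max(D,Λ)² + (12B₁+5)(2κ₀+κ₁)/ω_M`, `A₁` as in `trueKernel_antidiagonal_flatness_shape`, `ω_M = (2M+1)π/β`.
Pure real analysis; nothing asserts (C), K3 or superconductivity.
References: BGM 2006 §2.1 (2.3)–(2.4) [cite: BenfattoGiulianiMastropietro2006]; FST II CPAM 51 (1998) §3 [cite: FeldmanSalmhoferTrubowitz1998].
-/

noncomputable section

namespace Summit.HubbardSuperconductivity.HubbardSuperconductivity.Theorems.C4a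

set_option linter.dupNamespace false -- summit = problem name (single-conjunct summit), D-0017

open Real Filter Set MeasureTheory intervalIntegral
open scoped Topology Interval
open Literature.MathematicalPhysics.QuantumLattice Literature.Analysis.SpecialFunctions

/-! ## §1 The tail numerator on the quadrant -/

/-- `N_tail(0,0) = 0`. [folklore] -/
theorem ppTailNumerator_zero_zero (β Λ : ℝ) (M : ℕ) : ppTailNumerator β Λ M 0 0 = 0 := by
  unfold ppTailNumerator ppSummand
  simp

/-- **`|N_tail(e,u)| ≤ (12B₁+5)/ω_M·(e+u)`** for `e, u ≥ 0`. [cite: BenfattoGiulianiMastropietro2006, §2.1 (2.3)-(2.4)] -/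
theorem abs_ppTailNumerator_le_sum {β Λ : ℝ} (hβ : 0 < β) (hΛ : 0 < Λ) {B₁ : ℝ} (hB₁ : ∀ x, |deriv salmhoferCutoff x| ≤ B₁) (M : ℕ)
    {e u : ℝ} (he : 0 ≤ e) (hu : 0 ≤ u) :
    |ppTailNumerator β Λ M e u| ≤ (12 * B₁ + 5) / ppFreq β M * (e + u) := by
  set S : ℝ := (12 * B₁ + 5) / ppFreq β M with hS
  have h1 : ‖ppTailNumerator β Λ M 0 u - ppTailNumerator β Λ M 0 0‖ ≤ S * (u - 0) :=
    norm_image_sub_le_of_norm_deriv_le_segment' (f := fun v => ppTailNumerator β Λ M 0 v) (f' := fun v => ppTailNumeratorDu β Λ M 0 v)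
      (fun v _ => (hasDerivAt_ppTailNumerator_u hβ hΛ hB₁ M 0 v).hasDerivWithinAt)
      (fun v _ => by rw [Real.norm_eq_abs]; exact abs_ppTailNumeratorDu_le hβ hΛ hB₁ M 0 v) u (right_mem_Icc.2 hu)
  have h2 : ‖ppTailNumerator β Λ M e u - ppTailNumerator β Λ M 0 u‖ ≤ S * (e - 0) :=
    norm_image_sub_le_of_norm_deriv_le_segment' (f := fun x => ppTailNumerator β Λ M x u) (f' := fun x => ppTailNumeratorDu β Λ M u x)
      (fun x _ => (hasDerivAt_ppTailNumerator_e hβ hΛ hB₁ M x u).hasDerivWithinAt)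
      (fun x _ => by rw [Real.norm_eq_abs]; exact abs_ppTailNumeratorDu_le hβ hΛ hB₁ M u x) e (right_mem_Icc.2 he)
  rw [ppTailNumerator_zero_zero, sub_zero, Real.norm_eq_abs] at h1
  rw [Real.norm_eq_abs, sub_zero] at h2
  calc |ppTailNumerator β Λ M e u| = |(ppTailNumerator β Λ M e u - ppTailNumerator β Λ M 0 u) + ppTailNumerator β Λ M 0 u| := by rw [sub_add_cancel]
    _ ≤ |ppTailNumerator β Λ M e u - ppTailNumerator β Λ M 0 u| + |ppTailNumerator β Λ M 0 u| := abs_add_le _ _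
    _ ≤ S * e + S * (u - 0) := add_le_add h2 h1
    _ = S * (e + u) := by ring

/-! ## §2 The tail kernel's flatness number -/

/-- **THE TAIL KERNEL IS FLAT UP TO `O(β/M)`**: every `D > 0`, `|κ| ≤ κ₀`, `|κ′| ≤ κ₁` on `[0,1]`:
`|∫_0^D [∂ᵤN_tail(e,D−e)κ(e/D)/D − N_tail(e,D−e)(κ′(e/D)(e/D) + κ(e/D))/D²] de| ≤ (12B₁+5)(2κ₀+κ₁)/ω_M`. [cite: FeldmanSalmhoferTrubowitz1998, §3] -/
theorem tailKernel_antidiagonal_flatness_le {β Λ : ℝ} (hβ : 0 < β) (hΛ : 0 < Λ) {B₁ : ℝ} (hB₁ : ∀ x, |deriv salmhoferCutoff x| ≤ B₁) (M : ℕ)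
    {κ κ' : ℝ → ℝ} {κ₀ κ₁ D : ℝ} (hκb : ∀ t ∈ Icc 0 1, |κ t| ≤ κ₀) (hκ'b : ∀ t ∈ Icc 0 1, |κ' t| ≤ κ₁) (hD : 0 < D) :
    |∫ e in (0 : ℝ)..D, (ppTailNumeratorDu β Λ M e (D - e) * κ (e / D) / D -
        ppTailNumerator β Λ M e (D - e) * (κ' (e / D) * (e / D) + κ (e / D)) / D ^ 2)| ≤ (12 * B₁ + 5) * (2 * κ₀ + κ₁) / ppFreq β M := by
  have hB0 := salmhoferB₁_nonneg hB₁
  have hωM := ppFreq_pos hβ M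
  set S : ℝ := (12 * B₁ + 5) / ppFreq β M with hS
  have hS0 : 0 ≤ S := by positivity
  have hκ₀ : 0 ≤ κ₀ := (abs_nonneg _).trans (hκb 0 (left_mem_Icc.2 zero_le_one))
  have hκ₁ : 0 ≤ κ₁ := (abs_nonneg _).trans (hκ'b 0 (left_mem_Icc.2 zero_le_one))
  have hpt : ∀ e ∈ Ι (0 : ℝ) D, ‖ppTailNumeratorDu β Λ M e (D - e) * κ (e / D) / D -
      ppTailNumerator β Λ M e (D - e) * (κ' (e / D) * (e / D) + κ (e / D)) / D ^ 2‖ ≤ S * (2 * κ₀ + κ₁) / D := fun e he => by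
    rw [uIoc_of_le hD.le] at he
    have ht : e / D ∈ Icc (0 : ℝ) 1 := ⟨div_nonneg he.1.le hD.le, (div_le_one hD).2 he.2⟩
    have hN := abs_ppTailNumerator_le_sum hβ hΛ hB₁ M he.1.le (by linarith [he.2] : 0 ≤ D - e)
    rw [add_sub_cancel] at hN
    have hDu := abs_ppTailNumeratorDu_le hβ hΛ hB₁ M e (D - e)
    have hk := hκb _ ht
    have hk' := hκ'b _ ht
    rw [Real.norm_eq_abs]
    refine (abs_sub _ _).trans ?_
    rw [abs_div, abs_div, abs_mul, abs_mul, abs_of_pos hD, abs_of_pos (pow_pos hD 2)]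
    have hA : |ppTailNumeratorDu β Λ M e (D - e)| * |κ (e / D)| / D ≤ S * κ₀ / D :=
      div_le_div_of_nonneg_right (mul_le_mul hDu hk (abs_nonneg _) hS0) hD.le
    have hB : |ppTailNumerator β Λ M e (D - e)| * |κ' (e / D) * (e / D) + κ (e / D)| / D ^ 2 ≤ S * D * (κ₁ + κ₀) / D ^ 2 := by
      refine div_le_div_of_nonneg_right (mul_le_mul hN ?_ (abs_nonneg _) (by positivity)) (pow_pos hD 2).le
      refine (abs_add_le _ _).trans (add_le_add ?_ hk)
      rw [abs_mul, abs_of_nonneg ht.1]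
      calc |κ' (e / D)| * (e / D) ≤ κ₁ * 1 := mul_le_mul hk' ht.2 ht.1 hκ₁
        _ = κ₁ := mul_one _
    calc |ppTailNumeratorDu β Λ M e (D - e)| * |κ (e / D)| / D + |ppTailNumerator β Λ M e (D - e)| * |κ' (e / D) * (e / D) + κ (e / D)| / D ^ 2
        ≤ S * κ₀ / D + S * D * (κ₁ + κ₀) / D ^ 2 := add_le_add hA hB
      _ = S * (2 * κ₀ + κ₁) / D := by field_simp; ring
  have h := intervalIntegral.norm_integral_le_of_norm_le_const hpt
  rw [Real.norm_eq_abs, sub_zero, abs_of_pos hD] at h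
  refine h.trans (le_of_eq ?_)
  rw [hS]
  field_simp

/-! ## §3 The window kernel: (N2) shape plus the tail constant -/

/-- One summand of `N` is continuous along any pair of continuous level maps. [folklore] -/
theorem continuous_ppSummand_comp {β Λ : ℝ} (hβ : 0 < β) (n : ℕ) {a b : ℝ → ℝ} (ha : Continuous a) (hb : Continuous b) :
    Continuous fun x : ℝ => ppSummand β Λ (a x) (b x) n := by
  have hω := (ppFreq_pos hβ n).ne'
  have hW := continuous_uvWeightFn_level Λ (ppFreq β n)
  have hL := continuous_lorentzian hω
  unfold ppSummand
  exact ((hW.comp ha).mul (hW.comp hb)).mul ((hL.comp ha).add (hL.comp hb))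

/-- One summand of `∂ᵤN` is continuous along any pair of continuous level maps. [folklore] -/
theorem continuous_ppSummandDu_comp {β Λ : ℝ} (hβ : 0 < β) (n : ℕ) {a b : ℝ → ℝ} (ha : Continuous a) (hb : Continuous b) :
    Continuous fun x : ℝ => ppSummandDu β Λ (a x) (b x) n := by
  have h := continuous_ppDuSummand (Λ := Λ) hβ n ha hb
  unfold ppSummandDu
  exact h

/-- The line functions of the true kernel are continuous: `e ↦ N(e,D−e)`, `e ↦ ∂ᵤN(e,D−e)`. [folklore] -/
theorem continuous_trueKernel_line {β Λ : ℝ} (hβ : 0 < β) (hΛ : 0 < Λ) {B₁ : ℝ} (hB₁ : ∀ x, |deriv salmhoferCutoff x| ≤ B₁) (D : ℝ) :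
    Continuous (fun e : ℝ => ppTrueNumerator β Λ e (D - e)) ∧ Continuous (fun e : ℝ => ppTrueNumeratorDu β Λ e (D - e)) :=
  ⟨continuous_iff_continuousAt.2 fun e => (hasDerivAt_ppTrueNumerator_line hβ hΛ hB₁ D e).continuousAt,
    continuous_ppTrueNumeratorDu_line hβ hΛ hB₁ D⟩

/-- The line functions of the window kernel are continuous (finite sums). [folklore] -/
theorem continuous_windowKernel_line {β : ℝ} (hβ : 0 < β) (Λ : ℝ) (M : ℕ) (D : ℝ) :
    Continuous (fun e : ℝ => ppWindowNumerator β Λ M e (D - e)) ∧ Continuous (fun e : ℝ => ppWindowNumeratorDu β Λ M e (D - e)) := by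
  unfold ppWindowNumerator ppWindowNumeratorDu
  exact ⟨continuous_const.mul (continuous_finsetSum _ fun n _ => continuous_ppSummand_comp hβ n continuous_id (continuous_const.sub continuous_id)),
    continuous_const.mul (continuous_finsetSum _ fun n _ => continuous_ppSummandDu_comp hβ n continuous_id (continuous_const.sub continuous_id))⟩

/-- **THE WINDOW KERNEL'S FLATNESS NUMBER IN (N2)'s SHAPE PLUS THE TAIL CONSTANT.**  Hypotheses of `trueKernel_antidiagonal_flatness_shape` (split `κ ∈ C¹`, `|κ| ≤ κ₀`,
`|κ′| ≤ κ₁` on `[0,1]`, `κ = 0` on `[t₁,∞)`, `0 ≤ t₁ < 1`) and a window `M`.  THEN for every `D > 0`: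
`|∫_0^D [∂ᵤN_M(e,D−e)κ(e/D)/D − N_M(e,D−e)(κ′(e/D)(e/D) + κ(e/D))/D²] de| ≤ A₁·Λ/max(D,Λ)² + (12B₁+5)(2κ₀+κ₁)/ω_M`.
[cite: FeldmanSalmhoferTrubowitz1998, §3] -/
theorem windowKernel_antidiagonal_flatness_shape {β Λ : ℝ} (hβ : 0 < β) (hΛ : 0 < Λ) {B₁ : ℝ} (hB₁ : ∀ x, |deriv salmhoferCutoff x| ≤ B₁) (M : ℕ)
    {κ κ' : ℝ → ℝ} {κ₀ κ₁ t₁ : ℝ} (hκ : ∀ t, HasDerivAt κ (κ' t) t) (hκ'c : Continuous κ') (hκb : ∀ t ∈ Icc 0 1, |κ t| ≤ κ₀)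
    (hκ'b : ∀ t ∈ Icc 0 1, |κ' t| ≤ κ₁) (ht₀ : 0 ≤ t₁) (ht₁ : t₁ < 1) (hκs : ∀ t, t₁ ≤ t → κ t = 0) {D : ℝ} (hD : 0 < D) :
    |∫ e in (0 : ℝ)..D, (ppWindowNumeratorDu β Λ M e (D - e) * κ (e / D) / D -
        ppWindowNumerator β Λ M e (D - e) * (κ' (e / D) * (e / D) + κ (e / D)) / D ^ 2)| ≤
      ((6 * B₁ + 5 / 2) * (2 * κ₀ + κ₁) * (4 / (1 - t₁) ^ 2) + κ₀ * (10 * B₁ + 7 / 2 + 2 / (β * Λ) + 1 / (1 - t₁))) * (Λ / max D Λ ^ 2) +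
        (12 * B₁ + 5) * (2 * κ₀ + κ₁) / ppFreq β M := by
  have hκc : Continuous κ := continuous_iff_continuousAt.2 fun t => (hκ t).continuousAt
  have hκD : Continuous fun e : ℝ => κ (e / D) := hκc.comp (continuous_id.div_const D)
  have hκ'D : Continuous fun e : ℝ => κ' (e / D) * (e / D) + κ (e / D) :=
    ((hκ'c.comp (continuous_id.div_const D)).mul (continuous_id.div_const D)).add hκD
  -- the three kernels' integrands
  set Kt : ℝ → ℝ := fun e => ppTrueNumeratorDu β Λ e (D - e) * κ (e / D) / D -
    ppTrueNumerator β Λ e (D - e) * (κ' (e / D) * (e / D) + κ (e / D)) / D ^ 2 with hKt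
  set Kl : ℝ → ℝ := fun e => ppTailNumeratorDu β Λ M e (D - e) * κ (e / D) / D -
    ppTailNumerator β Λ M e (D - e) * (κ' (e / D) * (e / D) + κ (e / D)) / D ^ 2 with hKl
  set Kw : ℝ → ℝ := fun e => ppWindowNumeratorDu β Λ M e (D - e) * κ (e / D) / D -
    ppWindowNumerator β Λ M e (D - e) * (κ' (e / D) * (e / D) + κ (e / D)) / D ^ 2 with hKw
  -- pointwise: window = true − tail
  have hpt : ∀ e, Kw e = Kt e - Kl e := fun e => by
    simp only [hKw, hKt, hKl]
    rw [ppTrueNumerator_eq_window_add_tail hβ Λ M e (D - e), ppTrueNumeratorDu_eq_window_add_tail hβ hΛ hB₁ M e (D - e)]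
    ring
  -- integrability (continuity)
  obtain ⟨hNc, hNDc⟩ := continuous_trueKernel_line hβ hΛ hB₁ D
  obtain ⟨hWc, hWDc⟩ := continuous_windowKernel_line hβ Λ M D
  have hKtc : Continuous Kt := ((hNDc.mul hκD).div_const D).sub ((hNc.mul hκ'D).div_const (D ^ 2))
  have hKwc : Continuous Kw := ((hWDc.mul hκD).div_const D).sub ((hWc.mul hκ'D).div_const (D ^ 2))
  have hKlc : Continuous Kl := by
    have : Kl = fun e => Kt e - Kw e := funext fun e => by rw [hpt e]; ring
    rw [this]; exact hKtc.sub hKwc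
  have hsplit : ∫ e in (0 : ℝ)..D, Kw e = (∫ e in (0 : ℝ)..D, Kt e) - ∫ e in (0 : ℝ)..D, Kl e := by
    rw [← intervalIntegral.integral_sub (hKtc.intervalIntegrable _ _) (hKlc.intervalIntegrable _ _)]
    exact intervalIntegral.integral_congr fun e _ => hpt e
  have h1 := trueKernel_antidiagonal_flatness_shape hβ hΛ hB₁ hκ hκ'c hκb hκ'b ht₀ ht₁ hκs hD
  have h2 := tailKernel_antidiagonal_flatness_le hβ hΛ hB₁ M (κ := κ) (κ' := κ') hκb hκ'b hD
  show |∫ e in (0 : ℝ)..D, Kw e| ≤ _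
  rw [hsplit]
  exact (abs_sub _ _).trans (add_le_add h1 h2)

end Summit.HubbardSuperconductivity.HubbardSuperconductivity.Theorems.C4a

end
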